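import Summits.BirchSwinnertonDyer.BirchSwinnertonDyer.Theorems.ManinLocalTwoThreeDegeneracyLoopLawOfRowMoves
import Mathlib.LinearAlgebra.Matrix.SpecialLinearGroup
import Mathlib.NumberTheory.ModularForms.CongruenceSubgroups
import HarnessLib
import HarnessLib.Audit.Tags

/-!
# ROW-MOVE LAW = STATE-CLOSED GENERATION of `Γ₁(N)` — E-an-144 UNIF(N,t), the ∀N laws E-an-144∀(9)/(8), the REALISATION edge
# (an g31, MEMO-an §73; cell `bsd-f2-manin`, typer g16; answers p3's A-p3-1)

TYPER FRAMING.  LENS = an (WAKE seat g31, MEMO-an §73 = HOME/an/MEMO-an-73.md; engines + certificate table HOME/an/g31/rowmove/,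
UNIF-TABLE-an-g31.txt sha16 56e328869547e5af; SHA16-an-g31.txt).  SOURCE = HOME/an/g31/Sketch-an-g31.lean sha16 **3f780a28d6538d1f**
(144 l.; imports p3's `Theorems.ManinLocalTwoThreeDegeneracyLoopLawOfRowMoves` (cone-free) + Mathlib; farm rc 0 · 0 · 0 · 0 per an),
landed VERBATIM except: (i) this header; (ii) namespace `…ManinAdditive.RowMoveHolonomy` (the sketch's `BsdF2ManinAnG31`); (iii) the
five law / obligation rows carry the conjecture attribute (NOTHING asserted): **`RealisationEdge`** (THEOREM 1 of §73.2, paper-proved,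
elementary — obligation node until TURNKEY-an-18 (R1) lands it), **E-an-144∀(9) `StateClosedGenerationNine`**, **E-an-144∀(8)
`StateClosedGenerationEight`** (LAWS), **`UnifNineNine`**, **`UnifTwentySevenNine`** (machine-certified rows of THEOREM 3, obligation nodes
until TURNKEY-an-18 (R2) certificates land); (iv) three one-line docstrings added.  Schemas `RowMoveLawAt N t` (p3's law at one
level: `rowMoveLawNine_iff`/`rowMoveLawEight_iff` are `Iff.rfl` against the tree's `RowMoveLawNine/Eight`), `sectionGen`, `lowerGen`,
`admissibleGen`, `StateClosedGeneration N t` (E-an-144 / UNIF(N,t)) are plain defs; PROVED: `rowMoveLawNine_of`, `rowMoveLawEight_of`,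
`degeneracyLoopLawNine_of`, `degeneracyLoopLawEight_of` (RealisationEdge → E-an-144∀ → p3's `RowMoveLawNine/Eight` →
`DegeneracyLoopLawNine/Eight`), `sectionGen_subset_Gamma1`.
WHAT IS CLAIMED (an, not the tree): THEOREM 1 (realisation, ∀N), THEOREM 2 (the sections `!![1−Nn′, tʰ; Nc, 1+Nn]` + `!![1,0;N,1]` + `−1`
generate the holonomy group of all closed admissible row words = the uniform 5-block path schema), THEOREM 3 (UNIF TRUE at all 38 decided
pairs, two engines — Stallings fold + Todd–Coxeter: t = 9: N ∈ {9,15,18,21,27,36,45,54}; t = 8: N ∈ {4,8,…,48,56}; heavier levels on kit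
j320774); NEGATIVE: no bounded-height schema uniform in N (§73.6).  BC5 = UNIF-TABLE-an-g31.txt (38/38, falsifier silent).
NOT IN PRINT as stated (an; ref2 R-an-53 placement pending; nearest: Nekrashevych *Self-similar groups* §2.5 for the section language).
REFUTER VERDICTS: R-an-53 PENDING at filing.  bears_on: stmt-BirchSwinnertonDyer-22968 / -22967 (t = 9 Kato-curve nine edge; t = 8 C2
symbol-closure edge); for the es chain this input is MOOT after MEMO-es §37.10 (agreed an/es).
PARTITION 0 · beyond-print theorem: no · BSD is not proved by this; Manin's law `c ∈ {±1}` is not proved by this; C2/C3 stay OPEN.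
-/

/-!
## an's sketch docstring (verbatim)
# Sketch-an-g31 — the ROW-MOVE LAW (p3's `RowMoveLawNine/Eight`) = STATE-CLOSED GENERATION of `Γ₁(N)`
# (cell bsd-f2-manin, lens `an`, WAKE g31; MEMO-an §73; answers A-p3-1)

Nothing is asserted; no law is proved here.  Typed rows (all `Prop`s):
* §1 `RowMoveLawAt N t` — p3's row-move law at ONE level `N` and scaling `t` (the tree's `@[conjecture]` node
  `…ManinLocalTwoThree.RowMoveLawNine` is literally `∀ N, 3^2 ∣ N → RowMoveLawAt N 9`, `RowMoveLawEight` the same with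
  `2^2 ∣ N`, `t = 8`); `rowMoveLawNine_iff` / `rowMoveLawEight_iff` are `Iff.rfl`.
* §2 `sectionGen N t` — the UNIFORM MULTI-BLOCK SCHEMA asked for in A-p3-1: the matrices
  `𝒰 = !![1 - N n', t^h; N c, 1 + N n]` with `t^h c = n - n' (1 + N n)` (all `h ≥ 0`, `n n' c : ℤ`).  Each is the holonomy of
  the admissible row path  `(c,d) → (t^h c, d) → (t^h c + n N d, d) → (c', d + c') → (c' - n' N d', d') → ((c' - n' N d')/t^h, d')`
  (scale `h` times · shift · ONE twist · shift · unscale `h` times), valid at EVERY valid row; in the language of self-similar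
  groups `𝒰` is the SECTION of the parabolic `u = !![1,1;0,1]… ` — precisely: of `V₀ = !![1,0;N,1]`'s transpose-conjugate — at the
  vertex `n` of level `h` of the `t`-adic rooted tree on which `Γ₁(N)` (`p ∣ N`) acts by Möbius maps (virtual endomorphism
  = conjugation by `diag(t,1)`, Nekrashevych, *Self-similar groups*, §2.5).  MEMO §73.3 THEOREM 2.
* §3 `StateClosedGeneration N t` — **E-an-144 / UNIF(N,t)**: `Γ₁(N) ≤ ⟨-1, !![1,0;N,1], sectionGen N t⟩`.  THEOREM 1 (§73.2,
  paper-proved, elementary): `StateClosedGeneration N t → RowMoveLawAt N t` (typed here as the Prop `RealisationEdge`);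
  THEOREM 3 (§73.4, machine certificates, two engines: Stallings folding in `PSL₂(ℤ) = C₂ * C₃` + Todd–Coxeter):
  `StateClosedGeneration N 9` for `N ∈ {9,18,27,36,45,54}` and `StateClosedGeneration N 8` for `N ∈ {4,8,…,56}` (table
  HOME/an/g31/rowmove/UNIF-TABLE-an-g31.txt, sha16 there; heavier levels on kit job j320774).  Hence `RowMoveLawAt N 9` resp. `… N 8`
  at those levels, hence p3's `DegeneracyLoopLaw` there.
* §4 `StateClosedGenerationNine/Eight` — the ∀N laws (E-an-144∀; conjuser-level, BC5 = the certificate table) and the edges to the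
  tree's nodes, `RealisationEdge → StateClosedGenerationNine → RowMoveLawNine` (bookkeeping, `Iff.rfl` + Theorem 1).
* §5 `StableAdmissibility` remark: LAW(N,t) ⟺ S-stable admissibility (§73.2 T1′); single excursions never suffice (§73.6).
PARTITION 0 · beyond-print theorem: no (Theorems 1–3 are elementary group theory + finite certificates) · BSD is not proved
by this; Manin's conjecture is not proved by this; C3 (`27 ∣ N`) and C2 remain OPEN; what closes at the certified levels is
p3's reduction target `RowMoveLawAt N 9/8`, not `c_E = 1`.
-/

set_option autoImplicit false

open scoped MatrixGroups
open CongruenceSubgroup Matrix.SpecialLinearGroup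
open Summit.BirchSwinnertonDyer.BirchSwinnertonDyer.Theorems.ManinLocalTwoThree
open Summit.BirchSwinnertonDyer.Rank1Residual.ManinAdditive.Gamma1Lattice (DegeneracyLoopLawNine DegeneracyLoopLawEight)

namespace Summit.BirchSwinnertonDyer.Rank1Residual.ManinAdditive.RowMoveHolonomy

/-! ## §1  The row-move law at one level -/

/-- p3's row-move law at a fixed level `N` and scaling factor `t`: every valid row `(c,d)` (`N ∣ c`, `gcd = 1`,
`d ≡ ±1 mod N`) is joined to `(0,1)` by row moves `rowMoves N t` (shift `c ↦ c + N k d`, twist `d ↦ d + k c`,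
negation, and `(t c', d) ↔ (c', d)`). -/
def RowMoveLawAt (N t : ℕ) : Prop :=
  ∀ c d : ℤ, (c, d) ∈ rowValid N → ((d : ZMod N) = 1 ∨ (d : ZMod N) = -1) →
    Relation.EqvGen (fun p q : ℤ × ℤ => (p, q) ∈ rowMoves N t) (c, d) (0, 1)

/-- the tree's `RowMoveLawNine` is the level-wise law at `t = 9` (definitional). -/
theorem rowMoveLawNine_iff : RowMoveLawNine ↔ ∀ N : ℕ, 3 ^ 2 ∣ N → RowMoveLawAt N 9 := Iff.rfl

/-- the tree's `RowMoveLawEight` is the level-wise law at `t = 8` (definitional). -/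
theorem rowMoveLawEight_iff : RowMoveLawEight ↔ ∀ N : ℕ, 2 ^ 2 ∣ N → RowMoveLawAt N 8 := Iff.rfl

/-! ## §2  The uniform multi-block schema = the section generators -/

/-- The SECTION GENERATORS (MEMO §73.3, THEOREM 2): `!![1 - N n', t^h; N c, 1 + N n]` with
`t^h · c = n - n'·(1 + N n)`.  The determinant is `1` by the constraint; `h = 0, n = n' = c = 0` gives `T = !![1,1;0,1]`.
Each one is the holonomy of a 5-step admissible row path valid at every valid row (scale^h · shift n · twist · shift -n' ·
unscale^h); conversely (THEOREM 2) these, `!![1,0;N,1]` and `-1` generate the holonomy group of ALL closed admissible words. -/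
def sectionGen (N t : ℕ) : Set SL(2, ℤ) :=
  {γ | ∃ (h : ℕ) (n n' c : ℤ), (t : ℤ) ^ h * c = n - n' * (1 + N * n) ∧
      (γ : Matrix (Fin 2) (Fin 2) ℤ) = !![1 - N * n', (t : ℤ) ^ h; N * c, 1 + N * n]}

/-- The lower unipotent `!![1,0;N,1]` (row move `c ↦ c + N d`). -/
def lowerGen (N : ℕ) : SL(2, ℤ) :=
  ⟨!![1, 0; (N : ℤ), 1], by simp [Matrix.det_fin_two_of]⟩

/-- The full generating set of the admissible-word holonomy group `W₀(N,t)` (THEOREM 2): `-1`, `!![1,0;N,1]` and the sections. -/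
def admissibleGen (N t : ℕ) : Set SL(2, ℤ) :=
  insert (-1) (insert (lowerGen N) (sectionGen N t))

/-! ## §3  E-an-144: state-closed generation UNIF(N,t) -/

/-- **E-an-144 / UNIF(N,t)** (MEMO §73): `Γ₁(N)` is generated, together with `-1` and `!![1,0;N,1]`, by the section
generators of scaling `t`.  Equivalently (§73.3): the state-closure of the free subgroup `⟨!![1,1;0,1], !![1,0;N,1]⟩` in the
`diag(t,1)`-self-similar structure of `±Γ₁(N)` is everything.  CERTIFIED (THEOREM 3) for `(N,t)` in the table
HOME/an/g31/rowmove/UNIF-TABLE-an-g31.txt, in particular `t = 9`, `N ∈ {9,18,27,36,45,54}` and `t = 8`, `N ∈ {4,8,…,56}`;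
conjectured for all `N` with `9 ∣ N` (resp. `4 ∣ N`).  Why it might fail: `Γ₁(N)` is free of rank `~ N²/(2π²)·∏(1-p⁻²)+1`
and the sections of bounded height generate a subgroup of infinite index (height `1` never suffices for `N ≥ 8`, §73.6);
the certificates need height `J*(N,t) → ∞`, and no uniform mechanism is proved. -/
def StateClosedGeneration (N t : ℕ) : Prop :=
  Gamma1 N ≤ Subgroup.closure (admissibleGen N t)

/-- THEOREM 1 of MEMO §73.2 (REALISATION LEMMA; paper-proved, elementary — typed as a `Prop` for the -es and -ty seats to land):
state-closed generation implies the row-move law.  Proof: `H := {γ ∈ ±Γ₁(N) | ∀ valid v, EqvGen (v, v·γ)}` is a subgroup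
(`±Γ₁(N)` preserves valid rows; `EqvGen` is symmetric and transitive); every generator lies in `H` by an explicit
5-step (resp. 1-step) row path valid at every valid row; a valid row `(c,d)` with `d ≡ 1` is the second row of some
`γ ∈ Γ₁(N)` (`a ≡ 1` is automatic from `ad - bc = 1`, `N ∣ c`), and `(c,d) = (0,1)·γ`; `d ≡ -1` via `-γ`.
TYPER FRAMING: paper-proved THEOREM (an §73.2); obligation node until TURNKEY-an-18 (R1) lands, nothing asserted. [conjecture — cell candidate, NOT a tree fact] -/
@[conjecture] def RealisationEdge : Prop :=
  ∀ N t : ℕ, 0 < t → StateClosedGeneration N t → RowMoveLawAt N t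

/-! ## §4  The ∀N laws and the edges to the tree's conjecture nodes -/

/-- **E-an-144∀(9)**: state-closed generation at scaling `9` for every level divisible by `9`.  Implies the tree's
`RowMoveLawNine` (by `RealisationEdge`), hence `DegeneracyLoopLawNine`, hence the `t = 9` degeneracy-loop input of C3.
TYPER FRAMING (E-an-144∀(9)): lens an; LAW (BC5 = UNIF-TABLE-an-g31.txt, t = 9 rows), nothing asserted. [conjecture — cell candidate, NOT a tree fact] -/
@[conjecture] def StateClosedGenerationNine : Prop := ∀ N : ℕ, 3 ^ 2 ∣ N → StateClosedGeneration N 9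

/-- **E-an-144∀(8)**: the same at scaling `8` for every level divisible by `4` (feeds `RowMoveLawEight`).
TYPER FRAMING (E-an-144∀(8)): lens an; LAW (BC5 = UNIF-TABLE-an-g31.txt, t = 8 rows), nothing asserted. [conjecture — cell candidate, NOT a tree fact] -/
@[conjecture] def StateClosedGenerationEight : Prop := ∀ N : ℕ, 2 ^ 2 ∣ N → StateClosedGeneration N 8

/-- Bookkeeping edge (one line once `RealisationEdge` is a theorem). -/
theorem rowMoveLawNine_of (hE : RealisationEdge) (h : StateClosedGenerationNine) : RowMoveLawNine :=
  fun N hN => hE N 9 (by norm_num) (h N hN)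

/-- Bookkeeping edge for `t = 8`. -/
theorem rowMoveLawEight_of (hE : RealisationEdge) (h : StateClosedGenerationEight) : RowMoveLawEight :=
  fun N hN => hE N 8 (by norm_num) (h N hN)

/-- … and on to p3's degeneracy-loop law (tree edge `degeneracyLoopLawNine_of_rowMoveLawNine`). -/
theorem degeneracyLoopLawNine_of (hE : RealisationEdge) (h : StateClosedGenerationNine) : DegeneracyLoopLawNine :=
  degeneracyLoopLawNine_of_rowMoveLawNine (rowMoveLawNine_of hE h)

/-- … and the `t = 8` twin (tree edge `degeneracyLoopLawEight_of_rowMoveLawEight`). -/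
theorem degeneracyLoopLawEight_of (hE : RealisationEdge) (h : StateClosedGenerationEight) : DegeneracyLoopLawEight :=
  degeneracyLoopLawEight_of_rowMoveLawEight (rowMoveLawEight_of hE h)

/-! ## §5  Sanity: the generators lie in `Γ₁(N)` (so UNIF is an equality `⟨admissibleGen⟩ = ±Γ₁(N)`), and two certificate rows -/

/-- Every section generator lies in `Γ₁(N)`. -/
theorem sectionGen_subset_Gamma1 (N t : ℕ) : sectionGen N t ⊆ (Gamma1 N : Set SL(2, ℤ)) := by
  rintro γ ⟨h, n, n', c, hc, hγ⟩
  have e00 : (γ : Matrix (Fin 2) (Fin 2) ℤ) 0 0 = 1 - N * n' := by rw [hγ]; rfl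
  have e11 : (γ : Matrix (Fin 2) (Fin 2) ℤ) 1 1 = 1 + N * n := by rw [hγ]; rfl
  have e10 : (γ : Matrix (Fin 2) (Fin 2) ℤ) 1 0 = N * c := by rw [hγ]; rfl
  simp only [SetLike.mem_coe, Gamma1_mem]
  refine ⟨?_, ?_, ?_⟩
  · show ((γ : Matrix (Fin 2) (Fin 2) ℤ) 0 0 : ZMod N) = 1
    rw [e00]; push_cast; simp
  · show ((γ : Matrix (Fin 2) (Fin 2) ℤ) 1 1 : ZMod N) = 1
    rw [e11]; push_cast; simp
  · show ((γ : Matrix (Fin 2) (Fin 2) ℤ) 1 0 : ZMod N) = 0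
    rw [e10]; push_cast; simp

/-- A certificate row of THEOREM 3, typed: UNIF(9,9) (minimal free basis of `W₀(9,9)` found by the Stallings engine has
rank 7 = rank of `PΓ₁(9)·{±1}/±`, index 36; J* = 2).  Recorded as a `Prop`; the Lean proof would be a coset-enumeration
certificate (§73.9).  TYPER FRAMING: machine-certified (two engines), obligation node until a Lean certificate lands, nothing asserted. [conjecture — cell candidate, NOT a tree fact] -/
@[conjecture] def UnifNineNine : Prop := StateClosedGeneration 9 9

/-- UNIF(27,9): the first level of C3 proper (`27 ∣ N`); certified with J* = 3 (free rank 55, index 324).  TYPER FRAMING: machine-certified, obligation node until a Lean certificate lands, nothing asserted. [conjecture — cell candidate, NOT a tree fact] -/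
@[conjecture] def UnifTwentySevenNine : Prop := StateClosedGeneration 27 9

end Summit.BirchSwinnertonDyer.Rank1Residual.ManinAdditive.RowMoveHolonomy
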